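import Summits.HubbardSuperconductivity.HubbardSuperconductivity.Theorems.LiebTwinDWavePolarisedDiscordancePairTransfer
import HarnessLib

/-!
# Route `LiebTwin`, crux `DWavePolarisedDiscordance` (stmt-HubbardSuperconductivity-15314), line `Sketch`:
# channel completeness (helper, `--supports`, stub `stub_channelCompleteness`)

The KINEMATIC conservation law behind `Tr G = −4·Leak` of the channel-exhaustion sum rule.
With `B_{uv} := configHop n u v` (the spinless hop `c†_u c_v` on `n`-particle configurations of the
fermionic torus of side `L`) and `σ := FermionTorus.ofTorusSite`, the relative-coordinate channel kernel of a
pair of Lieb-space matrices `(M, N)` is `chan(r, r') = Σ_{x,x'} Tr(M B_{σx,σx'} N B_{σ(x+r),σ(x'+r')}ᵀ)`.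
Its trace over channels collapses to rigid displacements:

  `Σ_r chan(r, r) = Σ_a Tr(M 𝒯_a N 𝒯_aᵀ)`,  `𝒯_a := Σ_x B_{σx, σ(x+a)}`.

Proof: pure finite-sum bookkeeping over the additive group `(ℤ/L)²` — substitute `x' = x + a`
(`Equiv.addLeft x`), commute the sums, substitute `y = x + r` (`Equiv.addLeft x` again, using
`x + a + r = (x + r) + a`), and pull both sums inside the trace by bilinearity of `Tr(M · N ·ᵀ)`.
True for ALL matrices `M, N`; no definition and no named fact is introduced. [folklore]
-/

-- the mandated namespace `Summit.<Summit>.<Problem>.Theorems` repeats `HubbardSuperconductivity`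
-- (single-problem summit, D-0017), which the `dupNamespace` linter flags on every declaration
set_option linter.dupNamespace false

namespace Summit.HubbardSuperconductivity.HubbardSuperconductivity.Theorems.LiebTwinChannelExhaustion

open Matrix Finset Literature.MathematicalPhysics.QuantumLattice Literature.Probability.LatticeModels

/-- Bilinearity bookkeeping: a double sum of `Tr(M B_x N C_yᵀ)` is the trace of the product of the summed
families, `Σ_x Σ_y Tr(M B_x N C_yᵀ) = Tr(M (Σ_x B_x) N (Σ_y C_y)ᵀ)`. [folklore] -/
theorem sum_sum_trace_mul_mul_mul_transpose {ι m : Type*} [Fintype ι] [Fintype m]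
    (M N : Matrix m m ℂ) (B C : ι → Matrix m m ℂ) :
    ∑ x, ∑ y, (M * B x * N * (C y)ᵀ).trace = (M * (∑ x, B x) * N * (∑ y, C y)ᵀ).trace := by
  rw [Matrix.transpose_sum, Matrix.mul_sum, Matrix.trace_sum, Finset.sum_comm]
  refine Finset.sum_congr rfl fun y _ => ?_
  rw [Matrix.mul_sum, Matrix.sum_mul, Matrix.sum_mul, Matrix.trace_sum]

/-- Reindexing bookkeeping over a finite additive commutative group: summing a kernel over the diagonal
relative channels `(x, x') ↦ (x + r, x' + r)` equals summing over rigid displacements `x' = x + a`,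
`y' = y + a` (substitute `x' = x + a`, then `y = x + r`). [folklore] -/
theorem sum_sum_sum_diag_shift_eq {G γ : Type*} [AddCommGroup G] [Fintype G] [AddCommMonoid γ]
    (F : G → G → G → G → γ) :
    ∑ r, ∑ x, ∑ x', F x x' (x + r) (x' + r) = ∑ a, ∑ x, ∑ y, F x (x + a) y (y + a) := by
  -- (1) substitute `x' = x + a`
  have h1 : ∀ r x : G, ∑ x', F x x' (x + r) (x' + r) = ∑ a, F x (x + a) (x + r) (x + r + a) := by
    intro r x
    refine (Fintype.sum_equiv (Equiv.addLeft x) _ _ fun a => ?_).symm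
    simp only [Equiv.coe_addLeft, add_right_comm x r a]
  -- (3) substitute `y = x + r`
  have h2 : ∀ a x : G, ∑ r, F x (x + a) (x + r) (x + r + a) = ∑ y, F x (x + a) y (y + a) := by
    intro a x
    exact Equiv.sum_comp (Equiv.addLeft x) (fun y => F x (x + a) y (y + a))
  simp_rw [h1, ← h2]
  -- (2) commute the sums `Σ_r Σ_x Σ_a = Σ_a Σ_x Σ_r`
  rw [Finset.sum_comm]
  refine (Finset.sum_congr rfl fun x _ => Finset.sum_comm).trans ?_
  rw [Finset.sum_comm]

/-- **Channel completeness** (stub `stub_channelCompleteness` of line `Sketch`, crux K3′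
`DWavePolarisedDiscordance`): for all Lieb-space matrices `M, N` on the fermionic torus of side `L`,
`Σ_r Σ_{x,x'} Tr(M B_{x x'} N B_{x+r, x'+r}ᵀ) = Σ_a Tr(M 𝒯_a N 𝒯_aᵀ)` with `𝒯_a = Σ_x B_{x, x+a}`,
`B_{uv} = configHop n (ofTorusSite u) (ofTorusSite v)`: the trace of the relative-coordinate channel kernel
collapses to rigid displacements (finite reindexing over `(ℤ/L)²` and bilinearity of `Tr(M · N ·ᵀ)`).
[folklore] -/
theorem stub_channelCompleteness :
    ∀ (L : ℕ) [NeZero L] (n : ℕ)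
      (M N : Matrix (Config (FermionTorus 2 L) n) (Config (FermionTorus 2 L) n) ℂ),
      ∑ r : TorusSite 2 L, ∑ x : TorusSite 2 L, ∑ x' : TorusSite 2 L,
          (M * configHop n (FermionTorus.ofTorusSite x) (FermionTorus.ofTorusSite x') * N *
            (configHop n (FermionTorus.ofTorusSite (x + r)) (FermionTorus.ofTorusSite (x' + r)))ᵀ).trace =
        ∑ a : TorusSite 2 L,
          (M * (∑ x : TorusSite 2 L, configHop n (FermionTorus.ofTorusSite x) (FermionTorus.ofTorusSite (x + a))) *
            N * (∑ x : TorusSite 2 L,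
              configHop n (FermionTorus.ofTorusSite x) (FermionTorus.ofTorusSite (x + a)))ᵀ).trace := by
  intro L _ n M N
  rw [sum_sum_sum_diag_shift_eq (fun x x' y y' : TorusSite 2 L =>
    (M * configHop n (FermionTorus.ofTorusSite x) (FermionTorus.ofTorusSite x') * N *
      (configHop n (FermionTorus.ofTorusSite y) (FermionTorus.ofTorusSite y'))ᵀ).trace)]
  exact Finset.sum_congr rfl fun a _ => sum_sum_trace_mul_mul_mul_transpose M N
    (fun x : TorusSite 2 L => configHop n (FermionTorus.ofTorusSite x) (FermionTorus.ofTorusSite (x + a)))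
    (fun y : TorusSite 2 L => configHop n (FermionTorus.ofTorusSite y) (FermionTorus.ofTorusSite (y + a)))

end Summit.HubbardSuperconductivity.HubbardSuperconductivity.Theorems.LiebTwinChannelExhaustion
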